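import Literature.NumberTheory.LFunctions.TuringMethodWindow
import Literature.NumberTheory.LFunctions.TuringMethodProofs
import Literature.NumberTheory.LFunctions.TuringMethodTuringBound
import Literature.NumberTheory.LFunctions.TuringMethodTrudgianIIHolds
import HarnessLib

/-!
# Window certificates for `N(T)`, unconditionally

`Literature.NumberTheory.LFunctions.TuringMethodWindow` assembles both halves of Turing's method into
`zetaZeroCount_eq_of_turing_window`: strict sign changes of Hardy's `Z` in a window `[T − h', T + h]`
plus two explicit real inequalities, fed by ANY two-sided bound `|∫_{t₁}^{t₂} S| ≤ A(t₂)` (`t₁ > c`),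
give the exact count `N(T) = n`; its specialisation `zetaZeroCount_eq_of_turing_window_trudgian`
takes Trudgian's 2011 bound as the hypothesis `(hTr : abs_integral_zetaArgS_le_trudgian)`.

All three printed bounds of this shape are meanwhile THEOREMS of the tree:
* `abs_integral_zetaArgS_le_turing_holds` (Turing 1953 / Lehman 1970 in Edwards' form,
  `2.30 + 0.128 log (t₂/2π)`, `t₁ > 168π`; file `TuringMethodTuringBound`),
* `abs_integral_zetaArgS_le_trudgian_holds` (Trudgian 2011, Thm 2.2, `2.067 + 0.059 log t₂`,
  `t₁ > 168π`; file `TuringMethodProofs`),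
* `abs_integral_zetaArgS_le_trudgianII_holds` (Trudgian 2016, Thm 1,
  `1.698 + 0.183 log log t₂ + 0.049 log t₂`, `t₁ > 10⁵`; file `TuringMethodTrudgianIIHolds`).

This file plugs them in, so that a window certificate (e.g. the ones pinning `N(32 585 736.4) = 75 000 000`
or `N(3 000 175 332 800) = 12 363 153 437 138`) is a statement with NO named-fact hypothesis: the only
inputs left are the sign-change abscissae and the two rational inequalities. (The same service that
`TuringMethodProofs` renders for the one-sided `of_turing_trudgian'`.)

Axioms. `zetaZeroCount_eq_of_turing_window_turing'` is kernel-clean (`propext`, `Classical.choice`,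
`Quot.sound` only — `abs_integral_zetaArgS_le_turing_holds` is a pen-and-paper discharge). The two
Trudgian variants inherit exactly one compiled auxiliary each from the tree's discharges
(`TrudgianNumerics.trudgianCheck_eq_true`, resp. `TrudgianIIChain.chainCheck_eq_true`, both
`native_decide` checks of printed numerical tables), i.e. they are computational nodes in the sense of
`TuringMethodProofs`; a consumer who wants the standard axiom set uses the `_turing'` form (every
ENGINE-2 certificate of the verify track closes under that bound as well).

## Main results (namespace `Literature.NumberTheory.LFunctions`)

* `zetaZeroCount_eq_of_turing_window_turing'` — with the Turing–Lehman bound, `T − h' > 168π`.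
* `zetaZeroCount_eq_of_turing_window_trudgian'` — with Trudgian 2011, `T − h' > 168π`.
* `zetaZeroCount_eq_of_turing_window_trudgianII'` — with Trudgian 2016, `T − h' > 10⁵`.

Not here: Gram blocks / Rosser's rule (deliberately not formalised anywhere in the tree, see the
module docstring of `TuringMethod`).

[cite: EdwardsZeta1974, §8.2]; [cite: Brent1979, Thm. 3.2]; [cite: Trudgian2011, Thm. 2.2];
[cite: Trudgian2016, Thm. 1]
-/

noncomputable section

open scoped Real

namespace Literature.NumberTheory.LFunctions

/-- **Window certificate with the Turing–Lehman bound, unconditionally.** For `168π < T − h'`,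
`0 < h`, `0 < h'`: if Hardy's `Z` has `m` strict sign changes along `T ≤ s_0 < ⋯ < s_m ≤ T + h` and
`m'` strict sign changes along `T − h' ≤ s'_0 < ⋯ < s'_{m'} ≤ T`, and
`2.30 + 0.128 log((T+h)/2π) + ∫_T^{T+h} (θ/π + 1) − Σ_{j<m} (T + h − s_{j+1}) < h (n + 1)` and
`h' (n − 1) < Σ_{j<m'} (s'_j − (T − h')) + ∫_{T−h'}^{T} (θ/π + 1) − (2.30 + 0.128 log(T/2π))`,
then `N(T) = n`. (`zetaZeroCount_eq_of_turing_window` with `abs_integral_zetaArgS_le_turing_holds`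
plugged in.) [cite: EdwardsZeta1974, §8.2] -/
theorem zetaZeroCount_eq_of_turing_window_turing'
    {T h h' : ℝ} {n m m' : ℕ} (hc : 168 * π < T - h') (hh : 0 < h) (hh' : 0 < h')
    (s : Fin (m + 1) → ℝ) (hs : StrictMono s) (hs0 : T ≤ s 0) (hsm : s (Fin.last m) ≤ T + h)
    (hssign : ∀ i : Fin m, hardyZ (s i.castSucc) * hardyZ (s i.succ) < 0)
    (s' : Fin (m' + 1) → ℝ) (hs' : StrictMono s') (hs'0 : T - h' ≤ s' 0)
    (hs'm : s' (Fin.last m') ≤ T)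
    (hs'sign : ∀ i : Fin m', hardyZ (s' i.castSucc) * hardyZ (s' i.succ) < 0)
    (hup : 2.30 + 0.128 * Real.log ((T + h) / (2 * π))
        + (∫ t in T..T + h, (riemannSiegelTheta t / π + 1))
        - ∑ i : Fin m, (T + h - s i.succ) < h * (n + 1))
    (hlow : h' * ((n : ℝ) - 1) < ∑ i : Fin m', (s' i.castSucc - (T - h'))
        + (∫ t in (T - h')..T, (riemannSiegelTheta t / π + 1))
        - (2.30 + 0.128 * Real.log (T / (2 * π)))) :
    zetaZeroCount T = n := by
  have hT : 0 ≤ T - h' := le_of_lt (lt_trans (by positivity) hc)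
  exact zetaZeroCount_eq_of_turing_window (A := fun t ↦ 2.30 + 0.128 * Real.log (t / (2 * π)))
    (fun t₁ t₂ h1 h2 ↦ abs_integral_zetaArgS_le_turing_holds h1 h2) hc hT hh hh' s hs hs0 hsm hssign
    s' hs' hs'0 hs'm hs'sign hup hlow

/-- **Window certificate with Trudgian's 2011 bound, unconditionally.**
`zetaZeroCount_eq_of_turing_window_trudgian` with its hypothesis `abs_integral_zetaArgS_le_trudgian`
discharged by `abs_integral_zetaArgS_le_trudgian_holds`: for `168π < T − h'`, `0 < h`, `0 < h'`, sign
changes of `Z` in `[T − h', T + h]` and the two inequalities with `A(t) = 2.067 + 0.059 log t` give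
`N(T) = n`. [cite: Trudgian2011, Thm. 2.2] -/
theorem zetaZeroCount_eq_of_turing_window_trudgian'
    {T h h' : ℝ} {n m m' : ℕ} (hc : 168 * π < T - h') (hh : 0 < h) (hh' : 0 < h')
    (s : Fin (m + 1) → ℝ) (hs : StrictMono s) (hs0 : T ≤ s 0) (hsm : s (Fin.last m) ≤ T + h)
    (hssign : ∀ i : Fin m, hardyZ (s i.castSucc) * hardyZ (s i.succ) < 0)
    (s' : Fin (m' + 1) → ℝ) (hs' : StrictMono s') (hs'0 : T - h' ≤ s' 0)
    (hs'm : s' (Fin.last m') ≤ T)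
    (hs'sign : ∀ i : Fin m', hardyZ (s' i.castSucc) * hardyZ (s' i.succ) < 0)
    (hup : 2.067 + 0.059 * Real.log (T + h) + (∫ t in T..T + h, (riemannSiegelTheta t / π + 1))
        - ∑ i : Fin m, (T + h - s i.succ) < h * (n + 1))
    (hlow : h' * ((n : ℝ) - 1) < ∑ i : Fin m', (s' i.castSucc - (T - h'))
        + (∫ t in (T - h')..T, (riemannSiegelTheta t / π + 1)) - (2.067 + 0.059 * Real.log T)) :
    zetaZeroCount T = n :=
  zetaZeroCount_eq_of_turing_window_trudgian abs_integral_zetaArgS_le_trudgian_holds hc hh hh' s hs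
    hs0 hsm hssign s' hs' hs'0 hs'm hs'sign hup hlow

/-- **Window certificate with Trudgian's 2016 bound, unconditionally.** For `10⁵ < T − h'`,
`0 < h`, `0 < h'`: sign changes of `Z` in `[T − h', T + h]` and the two inequalities with
`A(t) = 1.698 + 0.183 log log t + 0.049 log t` give `N(T) = n`
(`zetaZeroCount_eq_of_turing_window` with `abs_integral_zetaArgS_le_trudgianII_holds` plugged in).
[cite: Trudgian2016, Thm. 1] -/
theorem zetaZeroCount_eq_of_turing_window_trudgianII'
    {T h h' : ℝ} {n m m' : ℕ} (hc : (10 : ℝ) ^ 5 < T - h') (hh : 0 < h) (hh' : 0 < h')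
    (s : Fin (m + 1) → ℝ) (hs : StrictMono s) (hs0 : T ≤ s 0) (hsm : s (Fin.last m) ≤ T + h)
    (hssign : ∀ i : Fin m, hardyZ (s i.castSucc) * hardyZ (s i.succ) < 0)
    (s' : Fin (m' + 1) → ℝ) (hs' : StrictMono s') (hs'0 : T - h' ≤ s' 0)
    (hs'm : s' (Fin.last m') ≤ T)
    (hs'sign : ∀ i : Fin m', hardyZ (s' i.castSucc) * hardyZ (s' i.succ) < 0)
    (hup : 1.698 + 0.183 * Real.log (Real.log (T + h)) + 0.049 * Real.log (T + h)
        + (∫ t in T..T + h, (riemannSiegelTheta t / π + 1))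
        - ∑ i : Fin m, (T + h - s i.succ) < h * (n + 1))
    (hlow : h' * ((n : ℝ) - 1) < ∑ i : Fin m', (s' i.castSucc - (T - h'))
        + (∫ t in (T - h')..T, (riemannSiegelTheta t / π + 1))
        - (1.698 + 0.183 * Real.log (Real.log T) + 0.049 * Real.log T)) :
    zetaZeroCount T = n := by
  have hT : 0 ≤ T - h' := le_of_lt (lt_trans (by positivity) hc)
  exact zetaZeroCount_eq_of_turing_window
    (A := fun t ↦ 1.698 + 0.183 * Real.log (Real.log t) + 0.049 * Real.log t)
    (fun t₁ t₂ h1 h2 ↦ abs_integral_zetaArgS_le_trudgianII_holds h1 h2) hc hT hh hh' s hs hs0 hsm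
    hssign s' hs' hs'0 hs'm hs'sign hup hlow

end Literature.NumberTheory.LFunctions

end
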